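import Summits.QuantumFields.BalabanUV.Beta.D1BFx.WilsonStencilRealised

/-!
# `BalabanUV.Beta.D1BFx.ColourlessAntisymmetry` — road «BF-x» for binder row D1, slot (SPLIT) ∕ leaf A1.ii, part 4b: AT THE COLOURLESS INSTANCE
# an3's MODEL VECTOR LIST REALISES AN ANTISYMMETRIC KERNEL, so an2's antisymmetrisation (`wilsonA`) is the IDENTITY on the `vecStn sTot` block of the
# Wilson list; hence the E-SECTOR SPLIT `SbE κ u = VEC + DIVₐ + REMₐ` — model vector stencil (feeds MAIN) + antisymmetrised longitudinal block (to be
# cancelled by the local Feynman completion of the R-sector) + antisymmetrised remainder (degree ≥ 7 class)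

HONEST DEPENDENCY (page 1, mandatory): continuum YM on T⁴ ⇐ BetaPertH ∧ nine spine estimates (0/9 proved); BetaPertH ⇐ (D1) ∧ (D4) ∧
CAP+tail; G-an2-4 gates asym, D1 and NE2/3/4.  HONEST FRAMING (cell contract, verbatim): «discharging `BetaPertH` makes Bałaban's UV
stability UNCONDITIONAL — a real constructive-QFT result; it is NOT the continuum limit and NOT the Clay problem.»  THIS MODULE DISCHARGES
NOTHING of the wall: [folklore] finite matrix ∕ list bookkeeping BY NAME over an3's `GradedStencilDictionary.real` (+ `transpose_elemIns`,
`copies_transpose`), `WilsonStencilZ4` (`vecStn`, `divStn`, `remStn`, `mainStn`, `wilsonStn`, `real_vecStn`), `GhostTable.current`, `SpinTable.spinVertex` ∕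
`vecVertex` ∕ `spinMat`, and this unit's parts 2–3 (`realK`, `realK_eq_real`, `trStn`, `reixStn`, `sbEStn`, `SbE_eq_realK`).  No `def`, no `Prop` minted,
nothing printed asserted, 0 sorry.  0 wall binders; NOT D1, NOT `BetaPertH`, NOT continuum, NOT Clay.

ABSOLUTE RULE (cell charter, verbatim): «No internally-minted statement may enter as a cited fact. Every hypothesis is either kernel-proved in
this package or a verbatim quotation of a PUBLISHED theorem with page reference. The manuscript(s) under audit are NOT citable for their own
disputed steps — they are the thing under adjudication; programme-internal (2001/route/tribunal) claims are never citable.»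

WHY (skeleton v1.6 slot (SPLIT) = A0 ∘ A1.ii; part 3 `WilsonStencilRealised`: `SbE κ u = realK u u (sbEStn κ)`, `sbEStn κ = ½•(reix W ++ (−1)•tr (reix W))`,
`W = wilsonStn κ 1 = (vecStn sTot κ 1 ++ 2•divStn κ 1) ++ remStn κ 1`).  an3 built its located-pair matrices to be SYMMETRIC Hessian blocks for a SKEW
colour matrix (`SpinTable.spinMat_transpose_of_skew`, `GhostTable.vertex₁_eq_current`); at the colourless instance `A = 1` (symmetric) the SAME matrices
for the model vector vertex are therefore ANTISYMMETRIC (§2: `current_transpose`, `spinVertex_transpose_of_symm`, `vecVertex_transpose_of_symm`), while the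
longitudinal block `divStn` and the remainder are not.  Consequently (§3–§4) the antisymmetrisation in `sbEStn` acts trivially on the `vecStn sTot` block
and `SbE` SPLITS as `VEC + DIVₐ + REMₐ` with `VEC := realK u u (reixStn ιU (vecStn sTot κ 1))` — EXACTLY the object whose frozen-leg bubble against
itself is an3's model table `8·cellForm − 8·D(g²)` (part 4a `ModelTablesRealised.bubble_vecStn_frozen` at `s = sTot`, `sTot² = 4`).  This is the E-sector
line of node A0's term list; the R-sector's local Feynman completion is to cancel `DIVₐ` (A1.i `FeynmanLocalVertex` is the torus-level statement; the
list-level statement is J5 ∕ A3.a business), `REMₐ` is `Graded 2` (A2's degree ≥ 7 class, `WilsonStencilZ4.graded_remStn`).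
* §1 list lemmas: `trStn_append`, `trStn_smulS`, `reixStn_append`, `reixStn_smulS`.
* §2 matrix lemmas on ANY additive group `Λ` (decidable equality): `real_trStn` (`real e zr zc (trStn V) = (real e zc zr V)ᵀ`), `real_reixStn`
  (`= (real e zr zc V).submatrix (Prod.map id f) (Prod.map id f)`), `spinMat_transpose_of_symm`, `current_transpose`,
  `spinVertex_transpose_of_symm`, **`vecVertex_transpose_of_symm`** (`Aᵀ = A ⟹ (vecVertex s e z μ A)ᵀ = −vecVertex s e z μ A`).
* §3 **`realK_trStn_reix_vecStn`**: `realK u u (trStn (reixStn ιU (vecStn s γ 1))) = −realK u u (reixStn ιU (vecStn s γ 1))`;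
  `realK_asym_reix_vecStn`: the antisymmetrised list realises the same kernel.
* §4 **`SbE_split`**: `SbE κ u = realK u u (reixStn ιU (vecStn sTot κ 1)) + ½•(realK u u (reixStn ιU (2•divStn κ 1)) − realK u u (trStn (reixStn ιU (2•divStn κ 1))))
  + ½•(realK u u (reixStn ιU (remStn κ 1)) − realK u u (trStn (reixStn ιU (remStn κ 1))))`.
Unit `b2b-balaban-beta-d1-p2` (road owner, gen 2); `LEAVES-BFx.md` row A1.ii (part 4b) ∕ A0 (E-sector line).
-/

open Finset
open scoped BigOperators
open Literature.MathematicalPhysics.QuantumFieldTheory.Balaban1983to89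
open Literature.MathematicalPhysics.QuantumFieldTheory.Balaban1983to89.Beta
open ExpKernelCalculus (Site MKer)
open DyadicShell (Pt)
open GradedBubbles (LP Stn smulS)
open BubbleTable (elemIns elemIns_apply)
open GhostTable (copies copies_transpose current transpose_elemIns elemIns_neg)
open SpinTable (spinDir spinDir_transpose spinDir_swap spinMat spinMat_apply spinVertex vecVertex)
open PlaquetteWeitzenbock (sTot)
open Summit.QuantumFields.BalabanUV.Beta.GradedStencilDictionary (lift real real_nil real_cons real_append real_smulS)
open Summit.QuantumFields.BalabanUV.Beta.WilsonStencilZ4 (vecStn divStn remStn mainStn wilsonStn real_vecStn)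
open Summit.QuantumFields.BalabanUV.Beta.D1BFx.GluonKernelSectors (SbE)
open Summit.QuantumFields.BalabanUV.Beta.D1BFx.StencilRealisation (realK realK_nil realK_cons)
open Summit.QuantumFields.BalabanUV.Beta.D1BFx.WilsonStencilRealised (realK_eq_real trStn trStn_nil trStn_cons reixStn reixStn_nil reixStn_cons
  realK_append realK_smulS ιU sbEStn SbE_eq_realK)

namespace Summit.QuantumFields.BalabanUV.Beta.D1BFx.ColourlessAntisymmetry

/-! ## §1 List lemmas -/

section Lists

variable {I J : Type*}

/-- [folklore] `trStn (V ++ W) = trStn V ++ trStn W`. -/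
theorem trStn_append (V W : Stn I) : trStn (V ++ W) = trStn V ++ trStn W := List.map_append

/-- [folklore] `trStn (c • V) = c • trStn V`. -/
theorem trStn_smulS (c : ℝ) (V : Stn I) : trStn (smulS c V) = smulS c (trStn V) := by
  induction V with
  | nil => rfl
  | cons p V ih =>
    have e1 : smulS c (p :: V) = ⟨p.x, p.y, c • p.m⟩ :: smulS c V := rfl
    have e2 : smulS c (trStn (p :: V)) = ⟨p.y, p.x, c • p.m.transpose⟩ :: smulS c (trStn V) := rfl
    rw [e1, trStn_cons, e2, ih, Matrix.transpose_smul]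

/-- [folklore] `reixStn f (V ++ W) = reixStn f V ++ reixStn f W`. -/
theorem reixStn_append (f : J → I) (V W : Stn I) : reixStn f (V ++ W) = reixStn f V ++ reixStn f W := List.map_append

/-- [folklore] `reixStn f (c • V) = c • reixStn f V`. -/
theorem reixStn_smulS (f : J → I) (c : ℝ) (V : Stn I) : reixStn f (smulS c V) = smulS c (reixStn f V) := by
  induction V with
  | nil => rfl
  | cons p V ih =>
    have e1 : smulS c (p :: V) = ⟨p.x, p.y, c • p.m⟩ :: smulS c V := rfl
    have e2 : smulS c (reixStn f (p :: V)) = ⟨p.x, p.y, c • p.m.submatrix f f⟩ :: smulS c (reixStn f V) := rfl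
    rw [e1, reixStn_cons, e2, ih, Matrix.submatrix_smul]
    rfl

end Lists

/-! ## §2 Matrix lemmas on any additive group -/

section Matrices

variable {Λ : Type*} [DecidableEq Λ] [AddCommGroup Λ] {I J C : Type*}

/-- [folklore] **THE TRANSPOSED LIST REALISES THE TRANSPOSED MATRIX** (base points swapped): `real e zr zc (trStn V) = (real e zc zr V)ᵀ`. -/
theorem real_trStn (e : Fin 4 → Λ) (zr zc : Λ) (V : Stn I) : real e zr zc (trStn V) = (real e zc zr V).transpose := by
  induction V with
  | nil => rw [trStn_nil, real_nil, real_nil, Matrix.transpose_zero]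
  | cons p V ih => rw [trStn_cons, real_cons, real_cons, Matrix.transpose_add, transpose_elemIns, ih]

/-- [folklore] **THE RE-INDEXED LIST REALISES THE RE-INDEXED MATRIX**: `real e zr zc (reixStn f V) = (real e zr zc V).submatrix (id × f) (id × f)`. -/
theorem real_reixStn (e : Fin 4 → Λ) (f : J → I) (zr zc : Λ) (V : Stn I) :
    real e zr zc (reixStn f V) = (real e zr zc V).submatrix (Prod.map id f) (Prod.map id f) := by
  induction V with
  | nil => rw [reixStn_nil, real_nil, real_nil, Matrix.submatrix_zero]; rfl
  | cons p V ih =>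
    rw [reixStn_cons, real_cons, real_cons, Matrix.submatrix_add, ih]
    rfl

/-- [folklore] **FOR A SYMMETRIC COLOUR MATRIX THE SPIN MATRIX IS ANTISYMMETRIC** (the colourless instance `A = 1`; companion of an3's
`spinMat_transpose_of_skew`). -/
theorem spinMat_transpose_of_symm [DecidableEq J] (β γ : J) {A : Matrix C C ℝ} (hA : A.transpose = A) :
    (spinMat β γ A).transpose = -spinMat β γ A := by
  ext ⟨a, k⟩ ⟨b, k'⟩
  have h : A b a = A a b := by
    have := congrFun (congrFun hA a) b
    simpa [Matrix.transpose_apply] using this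
  have hd : spinDir β γ k' k = -spinDir β γ k k' := by
    rw [← Matrix.transpose_apply (spinDir β γ) k k', spinDir_transpose, spinDir_swap, Matrix.neg_apply]
  rw [Matrix.transpose_apply, spinMat_apply, Matrix.neg_apply, spinMat_apply, h, hd]
  ring

/-- [folklore] **THE LATTICE CURRENT TRANSPOSES TO MINUS ITSELF WITH THE TRANSPOSED INTERNAL MATRIX**: `(current x e P)ᵀ = −current x e Pᵀ`. -/
theorem current_transpose (x e' : Λ) (P : Matrix C C ℝ) : (current x e' P).transpose = -current x e' P.transpose := by
  rw [current, current, Matrix.transpose_sub, transpose_elemIns, transpose_elemIns, neg_sub]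

/-- [folklore] **FOR A SYMMETRIC COLOUR MATRIX THE SPIN VERTEX IS ANTISYMMETRIC**: `(spinVertex e z γ A)ᵀ = −spinVertex e z γ A`. -/
theorem spinVertex_transpose_of_symm [Fintype J] [DecidableEq J] (e : J → Λ) (z : Λ) (γ : J) {A : Matrix C C ℝ} (hA : A.transpose = A) :
    (spinVertex e z γ A).transpose = -spinVertex e z γ A := by
  rw [spinVertex, Matrix.transpose_sum, ← sum_neg_distrib]
  refine sum_congr rfl fun β _ => ?_
  rw [Matrix.transpose_sub, transpose_elemIns, transpose_elemIns, spinMat_transpose_of_symm β γ hA, elemIns_neg, elemIns_neg, neg_sub_neg,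
    neg_sub]

/-- [folklore] **FOR A SYMMETRIC COLOUR MATRIX THE MODEL VECTOR VERTEX IS ANTISYMMETRIC**: `(vecVertex s e z μ A)ᵀ = −vecVertex s e z μ A` (in particular
at the colourless instance `A = 1`). -/
theorem vecVertex_transpose_of_symm [Fintype J] [DecidableEq J] (s : ℝ) (e : J → Λ) (z : Λ) (μ : J) {A : Matrix C C ℝ}
    (hA : A.transpose = A) : (vecVertex s e z μ A).transpose = -vecVertex s e z μ A := by
  rw [vecVertex, Matrix.transpose_add, Matrix.transpose_smul, current_transpose, copies_transpose, hA, spinVertex_transpose_of_symm e z μ hA,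
    neg_add, smul_neg]

end Matrices

/-! ## §3 The colourless model vector list realises an antisymmetric kernel -/

section Colourless

/-- [folklore] **`realK u u (trStn (reixStn ιU (vecStn s γ 1))) = −realK u u (reixStn ιU (vecStn s γ 1))`** — at the colourless instance the
(direction-reindexed) model vector list's transpose realises MINUS its kernel. -/
theorem realK_trStn_reix_vecStn (s : ℝ) (γ : Fin 4) (u : Pt) :
    realK u u (trStn (reixStn ιU (vecStn s γ (1 : Matrix Unit Unit ℝ)))) = -realK u u (reixStn ιU (vecStn s γ (1 : Matrix Unit Unit ℝ))) := by
  funext x z a b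
  rw [Pi.neg_apply, Pi.neg_apply, Pi.neg_apply, Pi.neg_apply, realK_eq_real, realK_eq_real, real_trStn, real_reixStn, Matrix.transpose_submatrix,
    real_vecStn, vecVertex_transpose_of_symm _ _ _ _ Matrix.transpose_one]
  simp only [Matrix.submatrix_apply, Matrix.neg_apply]

/-- [folklore] **THE ANTISYMMETRISED COLOURLESS MODEL VECTOR LIST REALISES THE SAME KERNEL**:
`realK u u (½•(V ++ (−1)•trStn V)) = realK u u V` for `V = reixStn ιU (vecStn s γ 1)`. -/
theorem realK_asym_reix_vecStn (s : ℝ) (γ : Fin 4) (u : Pt) :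
    realK u u (smulS (1 / 2) (reixStn ιU (vecStn s γ (1 : Matrix Unit Unit ℝ)) ++ smulS (-1) (trStn (reixStn ιU (vecStn s γ (1 : Matrix Unit Unit ℝ))))))
      = realK u u (reixStn ιU (vecStn s γ (1 : Matrix Unit Unit ℝ))) := by
  rw [realK_smulS, realK_append, realK_smulS, realK_trStn_reix_vecStn, smul_neg, neg_one_smul, neg_neg, ← two_smul ℝ, smul_smul]
  norm_num

end Colourless

/-! ## §4 The E-sector split -/

/-- [folklore] **THE E-SECTOR SPLIT `SbE = VEC + DIVₐ + REMₐ`.**  The road's Wilson fine stencil at the base bond `(κ, u)` is the kernel realisation of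
the colourless model vector list `vecStn sTot κ 1` (NO antisymmetrisation needed there) plus the antisymmetrised longitudinal block `2•divStn κ 1` plus the
antisymmetrised remainder `remStn κ 1` (all direction-reindexed by `ιU`). -/
theorem SbE_split (κ : Fin 4) (u : Pt) :
    SbE κ u = realK u u (reixStn ιU (vecStn sTot κ (1 : Matrix Unit Unit ℝ)))
      + (1 / 2 : ℝ) • (realK u u (reixStn ιU (smulS 2 (divStn κ (1 : Matrix Unit Unit ℝ))))
          - realK u u (trStn (reixStn ιU (smulS 2 (divStn κ (1 : Matrix Unit Unit ℝ))))))
      + (1 / 2 : ℝ) • (realK u u (reixStn ιU (remStn κ (1 : Matrix Unit Unit ℝ)))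
          - realK u u (trStn (reixStn ιU (remStn κ (1 : Matrix Unit Unit ℝ))))) := by
  have hW : wilsonStn κ (1 : Matrix Unit Unit ℝ) =
      (vecStn sTot κ (1 : Matrix Unit Unit ℝ) ++ smulS 2 (divStn κ 1)) ++ remStn κ 1 := rfl
  rw [SbE_eq_realK, sbEStn, hW, reixStn_append, reixStn_append, trStn_append, trStn_append, realK_smulS, realK_append, realK_append, realK_append,
    realK_smulS, realK_append, realK_append, realK_trStn_reix_vecStn]
  funext x z a b
  simp only [Pi.add_apply, Pi.sub_apply, Pi.smul_apply, Pi.neg_apply, smul_eq_mul]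
  ring

end Summit.QuantumFields.BalabanUV.Beta.D1BFx.ColourlessAntisymmetry
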